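/-
Copyright (c) 2026 the pub-hodgecm-mathlib formalisation cell (harness21).  Prover seat hodgecm-mathlib-F0P2-p09 (g2), Track B «K2-LIT»,
#184♮ = hLiu418 = `stmt-HodgeConjecture-24832`; socket #41, KIND 1 (K1-b♮), brick (ρ1) of K2Liu-p14 (g4)'s LINE WORD #6 (Q2) road — LEAD F0P6-plan (g14)
BATCH #139 (2) «(ρ1) → F0P2-p09 after (ρ3)».  THEOREMS ONLY (no `def`, no `instance`, no notation, no named-fact hypothesis, no `sorry`).
-/
import Summits.HodgeConjecture.HodgeConjecture.Theorems.K2LiuSiegelFourierCoeffDelta   -- ★ Φ1 (A2) `fourierCoeffDelta_unipDelta_mul` (the `N_Δ(𝔸)`-equivariance of `φ_S`)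
import HarnessLib

/-!
# Crux `HLiu418`, socket #41, KIND 1, brick (ρ1): A FOURIER COEFFICIENT OF A RIGHT-`b`-INVARIANT FUNCTION PICKS UP `ψ_S(b)`, HENCE VANISHES IF `ψ_S(b) ≠ 1`

Cell `hodgecm-mathlib`, crux item hLiu418 = `stmt-HodgeConjecture-24832` (helper lane `--supports … --as helper`, count-neutral), route of record `HCCMUnconditional`;
squad K2 ∕ K2Liu (L1, LEAD F0P6-plan (g14)), road `K2_Liu`, socket #41 `sig_K2LiuSiegelEisensteinContinuation`, KIND 1, organ (K1b-W) ∕ (K1b-♮) (line lead and desk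
K2Liu-p14 (g4)), the (Q2) «S-UNIFORMITY» road of LINE WORD #6: the middle-cell function is right-invariant under the unipotent points `n(b₀)` of the translated level
((ρ2) ★ `K2LiuMiddleCellFunctionRightInvariant`, F0P2-p10 (g2)); THIS FILE turns that into the vanishing of its `S`-th Fourier coefficient whenever `ψ_S(n(b₀)) ≠ 1` —
so `MID_S ≠ 0` forces `ψ_S ≡ 1` on the invariance lattice, which (ρ3) ★ `K2LiuKindOneLineCharacterBoundTwo` reads entrywise.
THE MATHEMATICS ([MoeglinWaldspurger1995, I.2.6, II.1.7], [Shimura1997, §18.1]).  ★ Φ1 (A2) `K2LiuSiegelFourierCoeffDelta.fourierCoeffDelta_unipDelta_mul` is the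
`N_Δ(𝔸)`-EQUIVARIANCE `φ_S(b·h) = ψ_S(b)·φ_S(h)` (left-invariance of `νN`, commutativity of `N_Δ(𝔸)`, weight independence — covering-weight currency, `νN`
left-invariant, `β` an `N_Δ(L⁺)`-covering weight with `∫β < ∞`, `u ↦ φ(u h)` continuous, bounded and left-`N_Δ(L⁺)`-invariant).  If moreover `φ(u·b·h) = φ(u·h)` for all
`u ∈ N_Δ(𝔸)` (right-invariance under `b` at `h`), then `φ_S(b·h) = φ_S(h)` by inspection of the integrand, so `(ψ_S(b) − 1)·φ_S(h) = 0`: **`ψ_S(b) ≠ 1 ⟹ φ_S(h) = 0`**.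
* `fourierCoeffDelta_mul_eq_self_of_right_invariant` — `φ_S(b·h) = φ_S(h)` under right-invariance (definitional, no hypotheses on `νN`, `β`).
* **`fourierCoeffDelta_eq_zero_of_right_invariant`** — the vanishing at `h`; **`fourierCoeffDelta_one_eq_zero_of_right_invariant`** — at `h = 1` with `φ(x·b) = φ(x)` (the
  shape of K2Liu-p14's DESK WORD #1).
HONEST LABEL.  Count-neutral helper (a corollary of ★ Φ1 (A2) by name); closes no socket by itself; `HC_CM` is proved only modulo the 7 printed citations
(2 remaining named inputs: hLiu418 = `stmt-HodgeConjecture-24832`, h413 = `stmt-HodgeConjecture-24833`) until rung 0 closes.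

## References
* [MoeglinWaldspurger1995] C. Mœglin, J.-L. Waldspurger, *Spectral decomposition and Eisenstein series* (1995): I.2.6 (Fourier coefficients along unipotent radicals),
  II.1.7 (constant terms and coefficients of Eisenstein series).
* [Shimura1997] G. Shimura, *Euler products and Eisenstein series*, CBMS 93 (1997): §18.1 (Fourier expansion along the Siegel radical).
-/

set_option autoImplicit false
set_option linter.dupNamespace false -- the mandated namespace repeats `HodgeConjecture.HodgeConjecture`

noncomputable section

open scoped Matrix ENNReal NNReal ComplexConjugate
open NumberField IsDedekindDomain MeasureTheory MeasureTheory.Measure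
open Literature.NumberTheory.Automorphic Literature.NumberTheory.Automorphic.UnitaryGroup Literature.NumberTheory.GaloisRepresentations
open Literature.NumberTheory.GelbartRogawski1991 Literature.NumberTheory.GelbartRogawski1991.GRConstruction
open Literature.NumberTheory.K2Lit.SiegelDoubled Literature.MeasureTheory.Group

namespace Summit.HodgeConjecture.HodgeConjecture.Cruxes.HLiu418.K2LiuFourierCoeffDeltaRightTranslate

open K2LiuSiegelUnipotentFourierDefs K2LiuUnipotentCoveringWeight K2LiuSiegelFourierCoeffDelta

variable (L : Type) [Field L] [NumberField L] [IsCMField L]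
variable {N M n : ℕ} (e : Fin N × Fin M ≃ Fin n)
  (dV : Fin N → L) (hdV : ∀ i, IsCMField.complexConj L (dV i) = dV i)
  (dW : Fin M → L) (hdW : ∀ i, IsCMField.complexConj L (dW i) = dW i)
  [MeasurableSpace (unipDelta L e dV hdV dW hdW)] [BorelSpace (unipDelta L e dV hdV dW hdW)]

omit [BorelSpace (unipDelta L e dV hdV dW hdW)] in
/-- **right-invariance under `b` at `h` makes the coefficient at `b·h` equal to the coefficient at `h`**: if `φ(u·b·h) = φ(u·h)` for all `u ∈ N_Δ(𝔸)`, then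
`φ_S(b·h) = φ_S(h)` (same integrand). [cite: MoeglinWaldspurger1995, I.2.6] -/
theorem fourierCoeffDelta_mul_eq_self_of_right_invariant (νN : Measure (unipDelta L e dV hdV dW hdW)) (β : unipDelta L e dV hdV dW hdW → ℝ≥0∞)
    (S : Matrix (Fin n) (Fin n) L) (φ : HA L e dV hdV dW hdW → ℂ) (h : HA L e dV hdV dW hdW) (b : unipDelta L e dV hdV dW hdW)
    (hbR : ∀ u : unipDelta L e dV hdV dW hdW, φ ((u : HA L e dV hdV dW hdW) * (b : HA L e dV hdV dW hdW) * h) = φ ((u : HA L e dV hdV dW hdW) * h)) :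
    fourierCoeffDelta L e dV hdV dW hdW νN β S φ ((b : HA L e dV hdV dW hdW) * h) = fourierCoeffDelta L e dV hdV dW hdW νN β S φ h := by
  rw [fourierCoeffDelta_def, fourierCoeffDelta_def]
  congr 1
  refine integral_congr_ae (Filter.Eventually.of_forall fun u => ?_)
  simp only
  rw [← mul_assoc, hbR u]

/-- **(ρ1) A FOURIER COEFFICIENT OF A RIGHT-`b`-INVARIANT FUNCTION VANISHES IF `ψ_S(b) ≠ 1`.**  `νN` a left-invariant measure on `N_Δ(𝔸)`, `β` an `N_Δ(L⁺)`-covering weight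
with `∫ β dνN < ∞`, `u ↦ φ(u·h)` continuous, bounded and left-`N_Δ(L⁺)`-invariant (the hypotheses of ★ Φ1 (A2) `fourierCoeffDelta_unipDelta_mul`), `b ∈ N_Δ(𝔸)` with
`φ(u·b·h) = φ(u·h)` for all `u` and `ψ_S(b) ≠ 1` ⟹ **`φ_S(h) = 0`** (`φ_S(b·h) = ψ_S(b)·φ_S(h)` by equivariance and `= φ_S(h)` by right-invariance).
[cite: MoeglinWaldspurger1995, I.2.6, II.1.7] [cite: Shimura1997, §18.1] -/
theorem fourierCoeffDelta_eq_zero_of_right_invariant (νN : Measure (unipDelta L e dV hdV dW hdW)) [νN.IsMulLeftInvariant]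
    {β : unipDelta L e dV hdV dW hdW → ℝ≥0∞} (hβ : IsCoveringWeight (unipDeltaRat L e dV hdV dW hdW) β) (hβtop : ∫⁻ u, β u ∂νN ≠ ∞)
    (S : Matrix (Fin n) (Fin n) L) {φ : HA L e dV hdV dW hdW → ℂ} {h : HA L e dV hdV dW hdW}
    (hφc : Continuous fun u : unipDelta L e dV hdV dW hdW => φ ((u : HA L e dV hdV dW hdW) * h))
    (hφb : ∃ C, ∀ u : unipDelta L e dV hdV dW hdW, ‖φ ((u : HA L e dV hdV dW hdW) * h)‖ ≤ C)
    (hφ : ∀ (γ : unipDeltaRat L e dV hdV dW hdW) (u : unipDelta L e dV hdV dW hdW),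
      φ ((((γ : unipDelta L e dV hdV dW hdW) * u : unipDelta L e dV hdV dW hdW) : HA L e dV hdV dW hdW) * h) = φ ((u : HA L e dV hdV dW hdW) * h))
    (b : unipDelta L e dV hdV dW hdW)
    (hbR : ∀ u : unipDelta L e dV hdV dW hdW, φ ((u : HA L e dV hdV dW hdW) * (b : HA L e dV hdV dW hdW) * h) = φ ((u : HA L e dV hdV dW hdW) * h))
    (hSb : unipDeltaChar L e dV hdV dW hdW S (b : HA L e dV hdV dW hdW) ≠ 1) :
    fourierCoeffDelta L e dV hdV dW hdW νN β S φ h = 0 := by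
  have heq := fourierCoeffDelta_unipDelta_mul L e dV hdV dW hdW νN hβ hβtop S hφc hφb hφ b
  rw [fourierCoeffDelta_mul_eq_self_of_right_invariant L e dV hdV dW hdW νN β S φ h b hbR] at heq
  -- `c = ψ·c` with `ψ ≠ 1` forces `c = 0`
  have hne : ((unipDeltaChar L e dV hdV dW hdW S (b : HA L e dV hdV dW hdW) : ℂ)) - 1 ≠ 0 :=
    fun h0 => hSb (Circle.coe_eq_one.1 (sub_eq_zero.1 h0))
  have hmul : (((unipDeltaChar L e dV hdV dW hdW S (b : HA L e dV hdV dW hdW) : ℂ)) - 1) * fourierCoeffDelta L e dV hdV dW hdW νN β S φ h = 0 := by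
    rw [sub_mul, one_mul, ← heq, sub_self]
  exact (mul_eq_zero.1 hmul).resolve_left hne

/-- **(ρ1) AT `h = 1`** (K2Liu-p14 (g4) DESK WORD #1 shape): `φ` with `x ↦ φ x` continuous along `N_Δ(𝔸)`, bounded there and left-`N_Δ(L⁺)`-invariant, RIGHT-invariant under
`b ∈ N_Δ(𝔸)` (`φ(x·b) = φ(x)` for all `x ∈ H(𝔸)`), and `ψ_S(b) ≠ 1` ⟹ `fourierCoeffDelta νN β S φ 1 = 0`. [cite: MoeglinWaldspurger1995, I.2.6, II.1.7] [cite: Shimura1997, §18.1] -/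
theorem fourierCoeffDelta_one_eq_zero_of_right_invariant (νN : Measure (unipDelta L e dV hdV dW hdW)) [νN.IsMulLeftInvariant]
    {β : unipDelta L e dV hdV dW hdW → ℝ≥0∞} (hβ : IsCoveringWeight (unipDeltaRat L e dV hdV dW hdW) β) (hβtop : ∫⁻ u, β u ∂νN ≠ ∞)
    (S : Matrix (Fin n) (Fin n) L) {φ : HA L e dV hdV dW hdW → ℂ}
    (hφc : Continuous fun u : unipDelta L e dV hdV dW hdW => φ (u : HA L e dV hdV dW hdW))
    (hφb : ∃ C, ∀ u : unipDelta L e dV hdV dW hdW, ‖φ (u : HA L e dV hdV dW hdW)‖ ≤ C)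
    (hφ : ∀ (γ : unipDeltaRat L e dV hdV dW hdW) (u : unipDelta L e dV hdV dW hdW),
      φ (((γ : unipDelta L e dV hdV dW hdW) * u : unipDelta L e dV hdV dW hdW) : HA L e dV hdV dW hdW) = φ (u : HA L e dV hdV dW hdW))
    (b : unipDelta L e dV hdV dW hdW) (hbR : ∀ x : HA L e dV hdV dW hdW, φ (x * (b : HA L e dV hdV dW hdW)) = φ x)
    (hSb : unipDeltaChar L e dV hdV dW hdW S (b : HA L e dV hdV dW hdW) ≠ 1) :
    fourierCoeffDelta L e dV hdV dW hdW νN β S φ 1 = 0 := by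
  refine fourierCoeffDelta_eq_zero_of_right_invariant L e dV hdV dW hdW νN hβ hβtop S (h := 1) ?_ ?_ ?_ b (fun u => ?_) hSb
  · simpa only [mul_one] using hφc
  · simpa only [mul_one] using hφb
  · simpa only [mul_one] using hφ
  · rw [mul_one, mul_one, hbR]

end Summit.HodgeConjecture.HodgeConjecture.Cruxes.HLiu418.K2LiuFourierCoeffDeltaRightTranslate

end
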